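import Summits.HodgeConjecture.HodgeConjecture.Cruxes.BlochSeedDiscOne.LinePhaseTorus
import Summits.HodgeConjecture.HodgeConjecture.Cruxes.BlochSeedDiscOne.PhaseTorusLawAllCoranks

/-!
# Two-term UP presentations at LARGE corank: apex padding and an explicit clean design with `μ ≠ 0` (s4-prove-2 g0, F1, 2026-08-29)

Crux of record `…Theses.EightfoldBlochSeeds.BlochSeedDiscOne` (stmt-HodgeConjecture-18881).  Nothing here proves HC, HC_AV, HC_CM, H2 or
18881; census-neutral; no fact, no instance, no notation.  Companion of `LinePhaseTorus.lean` 7bccd058 (the design-level dictionary: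
`lineTwoTermUp_mu_eq_zero_of_law γ` = «(A1)-clean integer LINE design + P-saturating UP flow + corank ≤ γ ⇒ μ = 0», GIVEN the torus law
`PhaseTorusLawN γ`) and of `PhaseTorusLawAllCoranks.lean` (the torus law FAILS from corank 16 on).

QUESTION (director-hodge R19.171 F1): can the two-term UP law be had at ALL coranks?  ANSWER AT DESIGN LEVEL (kernel, this file): **NO —
in the letter model of record the hypotheses «LINE + (A1) + UpFlow» do NOT force `μ = 0` once the corank is large**:
* `le_apexCell`: every LINE cell slides to the APEX cell `(h,0,0)⁴` (all charges `0`; `ch = e^{hH}`, (A1)-neutral), so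
* `apexFlow`: ANY configuration whose N-side contains the apex with multiplicity `≥ Σ m_P` carries a P-saturating UP flow (everything flows
  to the apex) — the corank is then `Σ_{N ≠ apex} m_N + (m_apex − Σ m_P)`, as large as one likes, and (A1) is untouched (`classScreen_apexCell`);
* `padDesign`: the PRODUCT DESIGN `ν(x) = 2·Re i^{k₀+k₁+k₂+k₃}` on the 256 unit cells `x = (ℓ_{k₀},…,ℓ_{k₃})` of LINE height `h` (N: `Σk ≡ 0 (4)`,
  P: `Σk ≡ 2 (4)`, multiplicity 2 each), padded by the apex with multiplicity `2·#P`: its weighted class tensor is EXACTLY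
  `256·(eeee + ēēēē) + 2·#P·ch(apex)` (`wch_padDesign`; the tensor identity `Σ_x i^{Σk} ⊗_f φ(x_f) = ⊗_f (Σ_k i^k φ(ℓ_k)) = 4⁴·eeee`), hence
  (A1)-clean with `μ = 256 ≠ 0`, all cells LINE cells, multiplicities ≥ 0, and `apexFlow` is an `UpFlow`:
  **`exists_clean_line_upflow_mu_ne_zero`** and **`not_lineTwoTermUp_all_coranks`** (the conclusion of `lineTwoTermUp_mu_eq_zero_of_law`
  cannot hold for every `γ`; consistent with the torus side: it would need `PhaseTorusLawN γ` for `γ ≥ 16`);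
* the POSITIVE side as far as the torus route carries today: **`lineTwoTermUp8_mu_eq_zero`** (corank ≤ 8, discharged by the kernel
  theorem `PhaseTorus.phaseTorusLaw8_holds` of `PhaseTorusLawAllCoranks.lean`).
READING.  Corank is not an obstruction parameter for two-term presentations in this model: padding by apex (or phase-balanced axis) line
bundles is (A1)-neutral and μ-neutral and supplies the flow.  What kills such padded «presentations» geometrically is FIBREWISE injectivity
(the unique section of `L_apex ⊗ L_x^{-1} = ⊠_f O(Γ_{ζ_f})` vanishes on a divisor, so the cokernel is not locally free) — a constant-rank ∕
degeneracy-locus condition (Porteous) that the König–Egerváry `UpFlow` does not encode.  So «C3(two-term) dead at ALL coranks» is not a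
statement of this model; the corank-free model statements are the DOWN law (`lineTwoTermDown_mu_eq_zero`) and the BOX∕E8 laws of the
torus side applied to the residual phase set.
-/

namespace Summit.HodgeConjecture.HodgeConjecture.Cruxes.BlochSeedDiscOne.LinePhaseTorus

open Finset BigOperators Summit.Ventures.HSemireg Summit.Ventures.HSemireg.Pad4Tower

/-! ## §1 The apex cell and the apex flow -/

/-- the APEX cell: the apex letter `(h, 0, 0)` (charge `0`) on every factor. -/
def apexCell (h : ℤ) : MCell := fun _ => lineLetter h 0 0

theorem apexCell_apply (h : ℤ) (f : Fin 4) : apexCell h f = (h, 0, 0) := by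
  simp [apexCell, lineLetter]

theorem apexCell_lineCell (h : ℤ) : LineCell h (apexCell h) := fun _ => ⟨0, 0, rfl⟩

/-- **every LINE cell slides to the apex**: `P ≤ apex` (per factor the difference `(c, −β)` is null-or-future: `|β|² = c²`). -/
theorem le_apexCell {h : ℤ} {P : MCell} (hP : LineCell h P) : MCell.le P (apexCell h) := by
  intro f
  obtain ⟨c, k, e⟩ := hP f
  rw [e, apexCell_apply]
  have hc : (0 : ℤ) ≤ c := by exact_mod_cast Nat.zero_le c
  fin_cases k <;> simp [lineLetter, Effective]

/-- **the apex flow**: if the apex is an N-cell of multiplicity `≥ Σ m_P`, sending every P-cell entirely to the apex is a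
P-saturating UP flow (live pairs by `le_apexCell`). -/
noncomputable def apexFlow (h : ℤ) (C : MConfig) (mN mP : MCell → ℤ) (hU : ∀ P ∈ C.upper, LineCell h P)
    (hapex : apexCell h ∈ C.lower) (hmN : ∀ Z, 0 ≤ mN Z) (hmP : ∀ P, 0 ≤ mP P)
    (hcap : ∑ P ∈ C.upper, mP P ≤ mN (apexCell h)) : UpFlow C mN mP := by
  classical
  refine
    { π := fun P N => if P ∈ C.upper ∧ N = apexCell h then (mP P).toNat else 0
      live := fun P N hne => ?_
      sat := fun P hP => ?_
      cap := fun N hN => ?_ }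
  · by_cases hc : P ∈ C.upper ∧ N = apexCell h
    · exact ⟨hc.1, hc.2 ▸ hapex, hc.2 ▸ le_apexCell (hU P hc.1)⟩
    · exact absurd (by simp [hc]) hne
  · rw [Finset.sum_eq_single (apexCell h) (fun N _ hN => by simp [hN]) (fun hna => absurd hapex hna)]
    simp [hP, Int.toNat_of_nonneg (hmP P)]
  · by_cases hNa : N = apexCell h
    · subst hNa
      refine le_trans (le_of_eq ?_) hcap
      refine Finset.sum_congr rfl fun P hP => ?_
      simp [hP, Int.toNat_of_nonneg (hmP P)]
    · rw [Finset.sum_eq_zero fun P _ => by simp [hNa]]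
      exact hmN N

/-! ## §2 (A1) is additive and the apex is (A1)-neutral -/

theorem classScreen_add {T T' : CWord → GaussianInt} (hT : ClassScreen T) (hT' : ClassScreen T') :
    ClassScreen (T + T') :=
  ⟨fun w h1 h2 h3 => by rw [Pi.add_apply, hT.1 w h1 h2 h3, hT'.1 w h1 h2 h3, add_zero],
    fun w w' hw hw' hd => by rw [Pi.add_apply, Pi.add_apply, hT.2 w w' hw hw' hd, hT'.2 w w' hw hw' hd]⟩

theorem classScreen_zsmul {T : CWord → GaussianInt} (hT : ClassScreen T) (n : ℤ) : ClassScreen (n • T) :=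
  ⟨fun w h1 h2 h3 => by rw [Pi.smul_apply, hT.1 w h1 h2 h3, smul_zero],
    fun w w' hw hw' hd => by rw [Pi.smul_apply, Pi.smul_apply, hT.2 w w' hw hw' hd]⟩

/-- the apex letter vector is `(1, h, h, 0, 0, h²)`: `h^{deg}` on e-free letters, `0` on `e, ē`. -/
theorem bphi_apex (h : ℤ) (l : Fin 6) :
    bphi ((h, 0, 0) : BPoint) l = if l = 3 ∨ l = 4 then 0 else (h : GaussianInt) ^ ldeg l := by
  fin_cases l <;> simp [bphi, phiVec, ldeg] <;> rfl

/-- **the apex is (A1)-neutral**: `ch(apex) = e^{hH}` has no e-letters and equal coefficients in each degree. -/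
theorem classScreen_apexCell (h : ℤ) : ClassScreen (apexCell h).ch := by
  have hch : ∀ w : CWord, (apexCell h).ch w = ∏ f, (if w f = 3 ∨ w f = 4 then 0 else (h : GaussianInt) ^ ldeg (w f)) :=
    fun w => by rw [ch_eq_prod]; exact Finset.prod_congr rfl fun f _ => by rw [apexCell_apply, bphi_apex]
  refine ⟨fun w h1 _ _ => ?_, fun w w' hw hw' hd => ?_⟩
  · rw [hch]
    obtain ⟨f, hf⟩ : ∃ f, w f = 3 ∨ w f = 4 := by
      by_contra hne; push Not at hne; exact h1 fun f => hne f
    exact Finset.prod_eq_zero (Finset.mem_univ f) (if_pos hf)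
  · rw [hch, hch, Finset.prod_congr rfl fun f _ => if_neg (not_or.2 (hw f)),
      Finset.prod_congr rfl fun f _ => if_neg (not_or.2 (hw' f)), Finset.prod_pow_eq_pow_sum,
      Finset.prod_pow_eq_pow_sum]
    congr 1
    simp only [wdeg, Fin.sum_univ_four] at hd ⊢
    exact hd

/-- the apex has no `eeee`-coefficient. -/
theorem apexCell_ch_eWord (h : ℤ) : (apexCell h).ch eWord = 0 := by
  rw [ch_eq_prod]
  exact Finset.prod_eq_zero (Finset.mem_univ 0) (by rw [apexCell_apply, bphi_apex]; rfl)

/-! ## §3 The product design `ν(x) = 2 Re i^{Σ k_f}` on the unit cells, padded by the apex -/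

/-- `i ∈ ℤ[i]`. -/
def iG : GaussianInt := ⟨0, 1⟩

/-- the unit cell with phases `x`: the letter `ℓ_{k_f} = (h − 1, conj(i^{k_f}))` on factor `f`. -/
def unitCell (h : ℤ) (x : Fin 4 → Fin 4) : MCell := fun f => lineLetter h 1 (x f)

theorem unitCell_lineCell (h : ℤ) (x : Fin 4 → Fin 4) : LineCell h (unitCell h x) := fun f => ⟨1, x f, rfl⟩

theorem lineLetter_one_injective (h : ℤ) : Function.Injective (lineLetter h 1) := by
  intro k k' e
  fin_cases k <;> fin_cases k' <;> simp_all [lineLetter]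

theorem unitCell_injective (h : ℤ) : Function.Injective (unitCell h) := by
  intro x y e
  funext f
  exact lineLetter_one_injective h (congr_fun e f)

theorem unitCell_ne_apexCell (h : ℤ) (x : Fin 4 → Fin 4) : unitCell h x ≠ apexCell h := by
  intro e
  have := congr_arg (fun Z : MCell => (Z 0).1) e
  simp [unitCell, apexCell, lineLetter] at this

/-- the design weight `ν(x) = i^{K} + conj(i^{K})`, `K = Σ_f k_f` (`= 2, 0, −2, 0` for `K ≡ 0, 1, 2, 3`). -/
def nu (x : Fin 4 → Fin 4) : GaussianInt := iG ^ (∑ f, (x f).val) + star (iG ^ (∑ f, (x f).val))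

theorem iG_pow_four : iG ^ 4 = 1 := by decide

theorem iG_pow_mod (n : ℕ) : iG ^ n = iG ^ (n % 4) := by
  conv_lhs => rw [← Nat.div_add_mod n 4, pow_add, pow_mul, iG_pow_four, one_pow, one_mul]

/-- `ν` takes only the values `2, −2, 0`. -/
theorem nu_cases (x : Fin 4 → Fin 4) : nu x = 2 ∨ nu x = -2 ∨ nu x = 0 := by
  unfold nu
  rw [iG_pow_mod]
  have h4 : (∑ f, (x f).val) % 4 < 4 := Nat.mod_lt _ (by norm_num)
  generalize (∑ f, (x f).val) % 4 = r at h4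
  interval_cases r <;> decide

/-- N-cells: `ν = 2`; P-cells: `ν = −2`. -/
def posX : Finset (Fin 4 → Fin 4) := Finset.univ.filter fun x => nu x = 2
def negX : Finset (Fin 4 → Fin 4) := Finset.univ.filter fun x => nu x = -2

/-- THE PADDED PRODUCT DESIGN: N = unit cells with `Σk ≡ 0` (mult. 2) and the apex (mult. `2·#P`); P = unit cells with `Σk ≡ 2` (mult. 2). -/
def padDesign (h : ℤ) : MConfig :=
  ⟨insert (apexCell h) (posX.image (unitCell h)), negX.image (unitCell h)⟩

/-- N-multiplicities: `2·#P` on the apex, `2` elsewhere. -/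
def padN (h : ℤ) : MCell → ℤ := fun Z => if Z = apexCell h then 2 * (negX.card : ℤ) else 2

/-- P-multiplicities: `2`. -/
def padP : MCell → ℤ := fun _ => 2

theorem padN_nonneg (h : ℤ) (Z : MCell) : 0 ≤ padN h Z := by
  unfold padN; split_ifs <;> positivity

theorem padP_nonneg (P : MCell) : 0 ≤ padP P := by unfold padP; norm_num

theorem pad_lineCell (h : ℤ) : ∀ Z ∈ (padDesign h).lower ∪ (padDesign h).upper, LineCell h Z := by
  intro Z hZ
  simp only [padDesign, Finset.mem_union, Finset.mem_insert, Finset.mem_image] at hZ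
  rcases hZ with (rfl | ⟨x, -, rfl⟩) | ⟨x, -, rfl⟩
  · exact apexCell_lineCell h
  · exact unitCell_lineCell h x
  · exact unitCell_lineCell h x

/-- the apex flow of the padded design. -/
noncomputable def padFlow (h : ℤ) : UpFlow (padDesign h) (padN h) padP :=
  apexFlow h (padDesign h) (padN h) padP
    (fun P hP => pad_lineCell h P (Finset.mem_union_right _ hP))
    (Finset.mem_insert_self _ _) (padN_nonneg h) padP_nonneg
    (by rw [padN, if_pos rfl, padDesign]; simp [padP, Finset.sum_const, Finset.card_image_of_injective _ (unitCell_injective h)];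
        ring_nf; rfl)

/-! ### the tensor identity `Σ_x ν(x)·ch(x) = 256·(eeee + ēēēē)` -/

/-- per-factor sums `Φ(l) = Σ_k i^k φ(ℓ_k)_l = 4·[l = e]` and `Φ'(l) = Σ_k i^{−k} φ(ℓ_k)_l = 4·[l = ē]`. -/
theorem factorSum (h : ℤ) (l : Fin 6) :
    ∑ k : Fin 4, iG ^ k.val * bphi (lineLetter h 1 k) l = if l = 3 then 4 else 0 := by
  fin_cases l <;> simp [Fin.sum_univ_four, bphi, phiVec, lineLetter, iG, Zsqrtd.ext_iff, pow_succ]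

theorem factorSum' (h : ℤ) (l : Fin 6) :
    ∑ k : Fin 4, star (iG ^ k.val) * bphi (lineLetter h 1 k) l = if l = 4 then 4 else 0 := by
  fin_cases l <;> simp [Fin.sum_univ_four, bphi, phiVec, lineLetter, iG, Zsqrtd.ext_iff, pow_succ, Zsqrtd.star_mk] <;> ring

/-- the word indicators. -/
theorem prod_ite_three (w : CWord) : (∏ f, (if w f = 3 then (4 : GaussianInt) else 0)) = if w = eWord then 256 else 0 := by
  by_cases hw : w = eWord
  · subst hw
    rw [if_pos rfl, Finset.prod_congr rfl fun f _ => if_pos (by fin_cases f <;> rfl)]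
    simp; norm_num
  · rw [if_neg hw]
    obtain ⟨f, hf⟩ : ∃ f, w f ≠ 3 := by
      by_contra hne; push Not at hne; exact hw (funext fun f => by rw [hne f]; fin_cases f <;> rfl)
    exact Finset.prod_eq_zero (Finset.mem_univ f) (if_neg hf)

theorem prod_ite_four (w : CWord) : (∏ f, (if w f = 4 then (4 : GaussianInt) else 0)) = if w = ebarWord then 256 else 0 := by
  by_cases hw : w = ebarWord
  · subst hw
    rw [if_pos rfl, Finset.prod_congr rfl fun f _ => if_pos (by fin_cases f <;> rfl)]
    simp; norm_num
  · rw [if_neg hw]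
    obtain ⟨f, hf⟩ : ∃ f, w f ≠ 4 := by
      by_contra hne; push Not at hne; exact hw (funext fun f => by rw [hne f]; fin_cases f <;> rfl)
    exact Finset.prod_eq_zero (Finset.mem_univ f) (if_neg hf)

/-- **the tensor identity**: `Σ_x ν(x)·ch(unit cell x) = 256·[w = eeee] + 256·[w = ēēēē]`. -/
theorem sum_nu_ch (h : ℤ) (w : CWord) :
    ∑ x : Fin 4 → Fin 4, nu x * (unitCell h x).ch w = (if w = eWord then 256 else 0) + (if w = ebarWord then 256 else 0) := by
  have h1 : ∑ x : Fin 4 → Fin 4, iG ^ (∑ f, (x f).val) * (unitCell h x).ch w = if w = eWord then 256 else 0 := by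
    rw [← prod_ite_three, ← Finset.prod_congr rfl fun f _ => factorSum h (w f), Finset.prod_univ_sum]
    simp only [Fintype.piFinset_univ]
    refine Finset.sum_congr rfl fun x _ => ?_
    rw [ch_eq_prod, ← Finset.prod_pow_eq_pow_sum, ← Finset.prod_mul_distrib]
    rfl
  have h2 : ∑ x : Fin 4 → Fin 4, star (iG ^ (∑ f, (x f).val)) * (unitCell h x).ch w = if w = ebarWord then 256 else 0 := by
    rw [← prod_ite_four, ← Finset.prod_congr rfl fun f _ => factorSum' h (w f), Finset.prod_univ_sum]
    simp only [Fintype.piFinset_univ]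
    refine Finset.sum_congr rfl fun x _ => ?_
    rw [ch_eq_prod, ← Finset.prod_pow_eq_pow_sum, star_prod, ← Finset.prod_mul_distrib]
    rfl
  simp only [nu, add_mul, Finset.sum_add_distrib, h1, h2]

/-- splitting the sum by the value of `ν ∈ {2, −2, 0}`. -/
theorem sum_nu_split (h : ℤ) (w : CWord) :
    ∑ x : Fin 4 → Fin 4, nu x * (unitCell h x).ch w =
      2 * ∑ x ∈ posX, (unitCell h x).ch w - 2 * ∑ x ∈ negX, (unitCell h x).ch w := by
  rw [Finset.mul_sum, Finset.mul_sum, posX, negX, Finset.sum_filter, Finset.sum_filter, ← Finset.sum_sub_distrib]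
  refine Finset.sum_congr rfl fun x _ => ?_
  rcases nu_cases x with e | e | e <;>
    simp [e, (by decide : (2 : GaussianInt) ≠ -2), (by decide : (-2 : GaussianInt) ≠ 2),
      (by decide : (0 : GaussianInt) ≠ 2), (by decide : (0 : GaussianInt) ≠ -2)]

/-- **the weighted class tensor of the padded design**: `256·(eeee + ēēēē) + 2·#P·ch(apex)`. -/
theorem wch_padDesign (h : ℤ) (w : CWord) :
    (padDesign h).wch (padN h) padP w =
      (if w = eWord then 256 else 0) + (if w = ebarWord then 256 else 0) + 2 * (negX.card : ℤ) * (apexCell h).ch w := by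
  have hnot : apexCell h ∉ posX.image (unitCell h) := by
    simp only [Finset.mem_image, not_exists, not_and]
    exact fun x _ => unitCell_ne_apexCell h x
  simp only [MConfig.wch, Pi.sub_apply, Finset.sum_apply, Pi.smul_apply, padDesign]
  simp only [zsmul_eq_mul]
  rw [Finset.sum_insert hnot, Finset.sum_image fun x _ y _ e => unitCell_injective h e,
    Finset.sum_image fun x _ y _ e => unitCell_injective h e]
  have hN : ∀ x ∈ posX, (padN h (unitCell h x) : GaussianInt) * (unitCell h x).ch w = 2 * (unitCell h x).ch w :=
    fun x _ => by rw [padN, if_neg (unitCell_ne_apexCell h x)]; push_cast; ring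
  rw [Finset.sum_congr rfl hN, padN, if_pos rfl]
  simp only [padP]
  rw [← sum_nu_ch, sum_nu_split, ← Finset.mul_sum, ← Finset.mul_sum]
  push_cast
  ring

/-- **the padded design passes (A1)** … -/
theorem classScreen_padDesign (h : ℤ) : ClassScreen ((padDesign h).wch (padN h) padP) := by
  have hfun : (padDesign h).wch (padN h) padP =
      (fun w => (if w = eWord then 256 else 0) + (if w = ebarWord then 256 else 0)) + (2 * (negX.card : ℤ)) • (apexCell h).ch := by
    funext w
    rw [wch_padDesign, Pi.add_apply, Pi.smul_apply, zsmul_eq_mul]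
    push_cast; ring
  rw [hfun]
  refine classScreen_add ⟨fun w _ h2 h3 => by simp [h2, h3], fun w w' hw hw' _ => ?_⟩ (classScreen_zsmul (classScreen_apexCell h) _)
  have e1 : w ≠ eWord := fun e => by subst e; exact (hw 0).1 rfl
  have e2 : w ≠ ebarWord := fun e => by subst e; exact (hw 0).2 rfl
  have e3 : w' ≠ eWord := fun e => by subst e; exact (hw' 0).1 rfl
  have e4 : w' ≠ ebarWord := fun e => by subst e; exact (hw' 0).2 rfl
  simp [e1, e2, e3, e4]

/-- **… and carries `μ = 256 ≠ 0`.** -/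
theorem wch_padDesign_eWord (h : ℤ) : (padDesign h).wch (padN h) padP eWord = 256 := by
  rw [wch_padDesign, if_pos rfl, if_neg (by decide), apexCell_ch_eWord]; ring

/-! ## §4 Conclusion: two-term UP presentations with `μ ≠ 0` exist in the letter model (corank `2·#N = 128`) -/

/-- **THERE IS an integer (A1)-clean LINE design with a P-saturating UP flow and `μ ≠ 0`** (every LINE height `h`). -/
theorem exists_clean_line_upflow_mu_ne_zero (h : ℤ) :
    ∃ (C : MConfig) (mN mP : MCell → ℤ), (∀ Z, 0 ≤ mN Z) ∧ (∀ P, 0 ≤ mP P) ∧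
      (∀ Z ∈ C.lower ∪ C.upper, LineCell h Z) ∧ ClassScreen (C.wch mN mP) ∧ Nonempty (UpFlow C mN mP) ∧
      C.wch mN mP eWord ≠ 0 :=
  ⟨padDesign h, padN h, padP, padN_nonneg h, padP_nonneg, pad_lineCell h, classScreen_padDesign h, ⟨padFlow h⟩,
    by rw [wch_padDesign_eWord]; decide⟩

/-- **the design-level UP law cannot hold at every corank**: the sentence of `lineTwoTermUp_mu_eq_zero_of_law γ` with its torus
hypothesis removed is false for `γ = ` the corank of `padDesign` (so, by that theorem, `PhaseTorusLawN γ` is false there too —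
cf. `PhaseTorusLawAllCoranks.not_phaseTorusLawN_of_le`). -/
theorem not_lineTwoTermUp_all_coranks (h : ℤ) :
    ¬ ∀ (γ : ℕ) (C : MConfig) (mN mP : MCell → ℤ), (∀ Z, 0 ≤ mN Z) → (∀ P, 0 ≤ mP P) →
        (∀ Z ∈ C.lower ∪ C.upper, LineCell h Z) → ClassScreen (C.wch mN mP) → UpFlow C mN mP →
        (∑ Z ∈ C.lower, mN Z) - (∑ P ∈ C.upper, mP P) ≤ (γ : ℤ) → C.wch mN mP eWord = 0 := by
  intro H
  have hcor : (∑ Z ∈ (padDesign h).lower, padN h Z) - (∑ P ∈ (padDesign h).upper, padP P) ≤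
      (((∑ Z ∈ (padDesign h).lower, padN h Z) - (∑ P ∈ (padDesign h).upper, padP P)).toNat : ℤ) := Int.self_le_toNat _
  have := H _ (padDesign h) (padN h) padP (padN_nonneg h) padP_nonneg (pad_lineCell h) (classScreen_padDesign h) (padFlow h) hcor
  rw [wch_padDesign_eWord] at this
  exact absurd this (by decide)

/-! ## §5 The positive side at design level: the UP law at corank `≤ 8` (discharged by `phaseTorusLaw8_holds`) -/

/-- **UP (cokernel orientation), corank ≤ 8** — the sentence of `lineTwoTermUp7_mu_eq_zero` with `7 ↦ 8`, its torus hypothesis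
DISCHARGED by the kernel theorem `PhaseTorus.phaseTorusLaw8_holds` (`PhaseTorusLawAllCoranks.lean` §7: box law + E8 law + the 8-set
dichotomy).  By `not_lineTwoTermUp_all_coranks` above no such sentence holds for every corank; by `PhaseTorus.not_phaseTorusLawN_of_le`
the torus route ends at the latest at corank 15. -/
theorem lineTwoTermUp8_mu_eq_zero (h : ℤ) (C : MConfig) (mN mP : MCell → ℤ)
    (hmN : ∀ Z, 0 ≤ mN Z) (hmP : ∀ P, 0 ≤ mP P)
    (hline : ∀ Z ∈ C.lower ∪ C.upper, LineCell h Z) (hA1 : ClassScreen (C.wch mN mP))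
    (F : UpFlow C mN mP) (hrank : (∑ Z ∈ C.lower, mN Z) - (∑ P ∈ C.upper, mP P) ≤ 8) :
    C.wch mN mP eWord = 0 :=
  lineTwoTermUp_mu_eq_zero_of_law 8 (fun ω A hA hω hK => PhaseTorus.phaseTorusLaw8_holds ω A hA hω fun k hk => hK k hk)
    h C mN mP hmN hmP hline hA1 F (by exact_mod_cast hrank)

end Summit.HodgeConjecture.HodgeConjecture.Cruxes.BlochSeedDiscOne.LinePhaseTorus
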